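import Summits.AnomalousDissipation.AnomalousDissipation.Theorems.SolenoidalFractalHomogenisationLagrangianStepCellLawVOddGainDefectCosineMixture
import Summits.AnomalousDissipation.AnomalousDissipation.Theorems.SolenoidalFractalHomogenisationLagrangianStepCellLawVQSSpectral
import Literature.Analysis.FluidPDE.QuasiStaticSlotWeightClosedForm
import HarnessLib

/-!
# K1L `LagrangianRenormalisationStep(Design)` (K1L_D, stmt-AnomalousDissipation-27980), stub `stub_cellLawV0_IS`, IS-half obligation
# `stub_W_evenSlackB` — the realised slot weight `ϑ(ρ, T)` is MONOTONE in the relaxation `T` (helper; `--supports … --as helper`; word-independent)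

Summits-side helper file of route `SolenoidalFractalHomogenisation` (prover seat `ad-sawtooth-k1loc-p1` g12, E1 even certificate of the IS-half line of
record `Cruxes/LagrangianRenormalisationStep/Lines/onelevel_W_crossing.lean` v2; planner ad-ideate-p5 g12 plan step (c) «λ-monotonicity»).  Along a ray
`S = S⋆/λ` the quasi-static slot response of a scalar-class slot is `f_T(β/λ) = λ·ϑ(ρ, Tβ/λ)/β`, so `(1/λ)·f_T(β/λ)` is DECREASING and `λ·f_T(λβ)`
INCREASING in `λ` exactly when `T ↦ ϑ(ρ, T)` is increasing — which reduces the two end-face inequalities of the even clause on `λ ∈ [λ₀, Λ]` to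
`λ = λ₀`.  Monotonicity of `ϑ` is NOT visible on the kernel `T e^{−Tu}`; it is the Majda–Kramer depletion law: by the landed COSINE MIXTURE
(`OddGain.cosineMixture_holds`, p5 g8 / k3l g5) `ϑ(ρ, c) = (1/π)∫₀^∞ Â_ρ(ξ)·c²/(c² + ξ²) dξ` with `Â_ρ = slotSpec ρ ≥ 0`, and `c²/(c² + ξ²)` increases in `c`.
* §1 `form_qsResp_smul_one` — `xᵀ f_T(a·1) z = f_T(a)·(x·z)` (spectral representation at the standard basis); `form_resolventAtom_smul_one` —
  `xᵀ R_s(c·1) z = (c/(c² + s))·(x·z)`;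
* §2 `qsRespScalar_eq_integral_slotSpec` — **`f_T(a) = (T/π)∫₀^∞ slotSpec ρ ξ · Ta/((Ta)² + ξ²) dξ`** (`T, a > 0`, `0 < ρ ≤ 1/2`), with integrability;
* §3 **`mul_qsRespScalar_mono`** — `0 < a ≤ b ⟹ a·f_T(a) ≤ b·f_T(b)`; **`slotWeight_mono`** — `0 < T ≤ T' ⟹ ϑ(ρ, T) ≤ ϑ(ρ, T')`;
  `qsRespScalar_div_antitone_ray` — `1 ≤ λ ≤ λ' ⟹ f_T(β/λ')/λ' ≤ f_T(β/λ)/λ` and `mul_qsRespScalar_mul_mono_ray` — `λ·f_T(λβ) ≤ λ'·f_T(λ'β)` (`β > 0`),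
  the two ray statements step (c) consumes;
* §4 `slotWeight_eq_closed_form`, **`qsRespScalar_eq_closed_form`** — the CLOSED FORM `ϑ(ρ,T) = ϑ_∞ − 2/(ρT²) + (2 − E)/(ρ²T³)`,
  `E = 2e^{−Tρ} − e^{−T(1−2ρ)} + 2e^{−T(1−ρ)} − e^{−T}` (ad-lit-style Literature lemma `LatticeShear.slotWeight_closed_form`) in the cell's currency,
  so that a certificate can enclose `f_T(β)` at the finitely many reference eigenvalues by rational arithmetic on exponentials.
Everything PROVED, no definition, no named fact, no sorry.  Infrastructure for rung leaf F-D1.A0; NOT a proof of the stub, of the crux, of Onsager's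
conjecture or of anomalous dissipation.
-/

set_option linter.dupNamespace false

noncomputable section

namespace Summit.AnomalousDissipation.AnomalousDissipation.Theorems.SolenoidalFractalHomogenisation.LagrangianStep

open Literature.Analysis Literature.Analysis.FluidPDE Literature.Analysis.FunctionSpaces
open MeasureTheory Set Real Matrix
open OddGain

/-! ## §1 Scalar blocks: the slot response and the resolvent atom of `a·1` -/

section ScalarBlock

/-- `xᵀ M z` in the double-sum currency of `…CellLawVQSResp`. [folklore] -/
theorem dotProduct_mulVec_eq_sum_sum (M : Matrix (Fin 3) (Fin 3) ℝ) (x z : Fin 3 → ℝ) :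
    x ⬝ᵥ M *ᵥ z = ∑ i, ∑ j, x i * M i j * z j := by
  rw [← sum_mul_mulVec_eq_sum_sum]; rfl

/-- **The slot response of a scalar block is the scalar response**: `xᵀ f_T(a·1) z = f_T(a)·(x·z)`. [folklore] -/
theorem form_qsResp_smul_one (ρ T a : ℝ) (x z : Fin 3 → ℝ) :
    x ⬝ᵥ (qsResp ρ T (a • (1 : Matrix (Fin 3) (Fin 3) ℝ))) *ᵥ z = qsRespScalar ρ T a * (x ⬝ᵥ z) := by
  have hsymm : (a • (1 : Matrix (Fin 3) (Fin 3) ℝ)).IsSymm := Matrix.isSymm_one.smul a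
  set q : OrthonormalBasis (Fin 3) ℝ (EuclideanSpace ℝ (Fin 3)) := EuclideanSpace.basisFun (Fin 3) ℝ with hq
  have heig : ∀ k, (a • (1 : Matrix (Fin 3) (Fin 3) ℝ)).mulVec (q k) = (fun _ => a) k • ⇑(q k) := by
    intro k
    rw [Matrix.smul_mulVec, Matrix.one_mulVec]
  rw [dotProduct_mulVec_eq_sum_sum, sum_sum_mul_qsResp_mul_eq_sum_eig hsymm q (fun _ => a) heig, ← Finset.mul_sum,
    ← sum_mul_eq_sum_eig q x z]
  rfl

/-- The inverse of an invertible scalar matrix. [folklore] -/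
theorem inv_smul_one {c : ℝ} (hc : c ≠ 0) : (c • (1 : Matrix (Fin 3) (Fin 3) ℝ))⁻¹ = c⁻¹ • (1 : Matrix (Fin 3) (Fin 3) ℝ) := by
  refine Matrix.inv_eq_left_inv ?_
  rw [smul_mul_smul_comm, mul_one, inv_mul_cancel₀ hc, one_smul]

/-- **The resolvent atom of a scalar block**: `xᵀ (c·1)((c·1)² + s)⁻¹ z = (c/(c² + s))·(x·z)` (`c² + s ≠ 0`). [folklore] -/
theorem form_resolventAtom_smul_one {c s : ℝ} (hcs : c * c + s ≠ 0) (x z : Fin 3 → ℝ) :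
    x ⬝ᵥ (resolventAtom (c • (1 : Matrix (Fin 3) (Fin 3) ℝ)) s) *ᵥ z = c / (c * c + s) * (x ⬝ᵥ z) := by
  unfold resolventAtom
  have h1 : c • (1 : Matrix (Fin 3) (Fin 3) ℝ) * (c • (1 : Matrix (Fin 3) (Fin 3) ℝ)) + s • (1 : Matrix (Fin 3) (Fin 3) ℝ)
      = (c * c + s) • (1 : Matrix (Fin 3) (Fin 3) ℝ) := by
    rw [smul_mul_smul_comm, mul_one, add_smul]
  rw [h1, inv_smul_one hcs, smul_mul_smul_comm, mul_one, Matrix.smul_mulVec, Matrix.one_mulVec, dotProduct_smul,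
    smul_eq_mul, div_eq_mul_inv]

end ScalarBlock

/-! ## §2 The scalar response as a cosine mixture -/

section Mixture

/-- The unit vector `e₀`. -/
private theorem dotProduct_single_zero_self : (Pi.single (0 : Fin 3) (1:ℝ)) ⬝ᵥ (Pi.single (0 : Fin 3) (1:ℝ)) = 1 := by
  simp [dotProduct, Pi.single_apply]

/-- **The scalar quasi-static response is a cosine mixture**: for `0 < ρ ≤ 1/2`, `T > 0`, `a > 0`,
`f_T(a) = (T/π)∫₀^∞ slotSpec ρ ξ · (Ta)/((Ta)² + ξ²) dξ`, the integrand being integrable on `(0, ∞)`.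
(The landed matrix cosine mixture `OddGain.cosineMixture_holds` at the scalar block `a·1`.) [folklore] -/
theorem qsRespScalar_eq_integral_slotSpec {ρ T a : ℝ} (hρ : 0 < ρ) (hρ2 : ρ ≤ 1 / 2) (hT : 0 < T) (ha : 0 < a) :
    IntegrableOn (fun ξ : ℝ => slotSpec ρ ξ * (T * a / (T * a * (T * a) + ξ ^ 2))) (Ioi 0) ∧
    qsRespScalar ρ T a = T / Real.pi * ∫ ξ in Ioi (0:ℝ), slotSpec ρ ξ * (T * a / (T * a * (T * a) + ξ ^ 2)) := by
  set x : Fin 3 → ℝ := Pi.single (0 : Fin 3) (1:ℝ) with hx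
  have hco : ∀ y : Fin 3 → ℝ, a * (y ⬝ᵥ y) ≤ y ⬝ᵥ (a • (1 : Matrix (Fin 3) (Fin 3) ℝ)) *ᵥ y := by
    intro y
    rw [Matrix.smul_mulVec, Matrix.one_mulVec, dotProduct_smul, smul_eq_mul]
  obtain ⟨hint, hval⟩ := cosineMixture_holds hρ hρ2 T hT (a • (1 : Matrix (Fin 3) (Fin 3) ℝ)) a ha hco x x
  have hatom : ∀ ξ : ℝ, x ⬝ᵥ (resolventAtom (T • (a • (1 : Matrix (Fin 3) (Fin 3) ℝ))) (ξ ^ 2)) *ᵥ x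
      = T * a / (T * a * (T * a) + ξ ^ 2) := by
    intro ξ
    have hne : T * a * (T * a) + ξ ^ 2 ≠ 0 := by positivity
    rw [smul_smul, form_resolventAtom_smul_one hne, hx, dotProduct_single_zero_self, mul_one]
  simp only [hatom] at hint hval
  refine ⟨hint, ?_⟩
  rw [← hval, form_qsResp_smul_one, hx, dotProduct_single_zero_self, mul_one]

/-- Integrability of the mixture against any measurable weight bounded by one (from `integrable_slotSpec`). [folklore] -/
theorem integrableOn_slotSpec_mul {ρ : ℝ} (hρ : 0 < ρ) (hρ2 : ρ ≤ 1 / 2) {g : ℝ → ℝ} (hg : Continuous g)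
    (hg1 : ∀ ξ, |g ξ| ≤ 1) : IntegrableOn (fun ξ : ℝ => slotSpec ρ ξ * g ξ) (Ioi 0) := by
  have hI := (integrable_slotSpec hρ (by linarith : ρ ≤ 1)).integrableOn (s := Ioi (0:ℝ))
  refine Integrable.mono' hI ?_ (Filter.Eventually.of_forall fun ξ => ?_)
  · exact ((measurable_slotSpec ρ).mul hg.measurable).aestronglyMeasurable
  · rw [Real.norm_eq_abs, abs_mul, abs_of_nonneg (slotSpec_nonneg ρ ξ)]
    calc slotSpec ρ ξ * |g ξ| ≤ slotSpec ρ ξ * 1 := mul_le_mul_of_nonneg_left (hg1 ξ) (slotSpec_nonneg ρ ξ)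
      _ = slotSpec ρ ξ := mul_one _

end Mixture

/-! ## §3 Monotonicity of `ϑ(ρ, T) = T·f_T(1)` in `T` and the two ray statements -/

section Monotone

/-- **`a·f_T(a)` is non-decreasing in `a > 0`** (`= ϑ(ρ, Ta)`, the realised weight at relaxation `Ta`): `0 < a ≤ b ⟹ a·f_T(a) ≤ b·f_T(b)`
(`T > 0`, `0 < ρ ≤ 1/2`).  [cite: MajdaKramer1999, §2.2.1.3 (55) (depletion factor λ²/(λ² + ω²), increasing in the relaxation rate)] -/
theorem mul_qsRespScalar_mono {ρ T a b : ℝ} (hρ : 0 < ρ) (hρ2 : ρ ≤ 1 / 2) (hT : 0 < T) (ha : 0 < a) (hab : a ≤ b) :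
    a * qsRespScalar ρ T a ≤ b * qsRespScalar ρ T b := by
  have hb : 0 < b := lt_of_lt_of_le ha hab
  obtain ⟨_, hfa⟩ := qsRespScalar_eq_integral_slotSpec hρ hρ2 hT ha
  obtain ⟨_, hfb⟩ := qsRespScalar_eq_integral_slotSpec hρ hρ2 hT hb
  -- `c·(T/π)∫ slotSpec·(Tc/((Tc)²+ξ²)) = (1/π)∫ slotSpec·((Tc)²/((Tc)²+ξ²))`
  set g : ℝ → ℝ → ℝ := fun c ξ => (T * c) * (T * c) / (T * c * (T * c) + ξ ^ 2) with hg
  have hgc : ∀ c, 0 < c → Continuous (g c) := by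
    intro c hc
    refine Continuous.div (by fun_prop) (by fun_prop) fun ξ => ?_
    positivity
  have hg1 : ∀ c ξ, |g c ξ| ≤ 1 := by
    intro c ξ
    have hden : 0 < T * c * (T * c) + ξ ^ 2 ∨ T * c * (T * c) + ξ ^ 2 = 0 := by
      rcases (add_nonneg (mul_self_nonneg (T * c)) (sq_nonneg ξ)).lt_or_eq with h | h
      · exact Or.inl h
      · exact Or.inr h.symm
    rcases hden with h | h
    · rw [hg, abs_of_nonneg (div_nonneg (mul_self_nonneg _) h.le), div_le_one h]
      linarith [sq_nonneg ξ]
    · rw [hg]; simp only [h, div_zero, abs_zero]; exact zero_le_one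
  have hrepr : ∀ c, 0 < c → c * qsRespScalar ρ T c = 1 / Real.pi * ∫ ξ in Ioi (0:ℝ), slotSpec ρ ξ * g c ξ := by
    intro c hc
    obtain ⟨_, hfc⟩ := qsRespScalar_eq_integral_slotSpec hρ hρ2 hT hc
    rw [hfc, ← mul_assoc, show c * (T / Real.pi) = 1 / Real.pi * (c * T) by ring, mul_assoc, ← integral_const_mul]
    congr 1
    refine integral_congr_ae (Filter.Eventually.of_forall fun ξ => ?_)
    simp only [hg]
    have hne : T * c * (T * c) + ξ ^ 2 ≠ 0 := by positivity
    field_simp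
  rw [hrepr a ha, hrepr b hb]
  refine mul_le_mul_of_nonneg_left ?_ (by positivity)
  refine setIntegral_mono_on (integrableOn_slotSpec_mul hρ hρ2 (hgc a ha) (hg1 a))
    (integrableOn_slotSpec_mul hρ hρ2 (hgc b hb) (hg1 b)) measurableSet_Ioi fun ξ _ => ?_
  refine mul_le_mul_of_nonneg_left ?_ (slotSpec_nonneg ρ ξ)
  -- `u ↦ u/(u + ξ²)` is non-decreasing on `u ≥ 0`, and `(Ta)² ≤ (Tb)²`
  simp only [hg]
  have hA : 0 < T * a * (T * a) := by positivity
  have hB : 0 < T * b * (T * b) := by positivity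
  have hAB : T * a * (T * a) ≤ T * b * (T * b) :=
    mul_self_le_mul_self (by positivity) (mul_le_mul_of_nonneg_left hab hT.le)
  rw [div_le_div_iff₀ (by positivity) (by positivity)]
  nlinarith [sq_nonneg ξ]

/-- **The realised slot weight `ϑ(ρ, T)` is non-decreasing in the relaxation `T`** (`0 < T ≤ T'`, `0 < ρ ≤ 1/2`).
[cite: MajdaKramer1999, §2.2.1.3 (55)] -/
theorem slotWeight_mono {ρ T T' : ℝ} (hρ : 0 < ρ) (hρ2 : ρ ≤ 1 / 2) (hT : 0 < T) (hTT' : T ≤ T') :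
    slotWeight ρ T ≤ slotWeight ρ T' := by
  have h1 : slotWeight ρ T = 1 * qsRespScalar ρ T 1 := by rw [mul_qsRespScalar_eq_slotWeight, mul_one]
  have h2 : slotWeight ρ T' = (T' / T) * qsRespScalar ρ T (T' / T) := by
    rw [mul_qsRespScalar_eq_slotWeight, mul_div_cancel₀ _ hT.ne']
  rw [h1, h2]
  exact mul_qsRespScalar_mono hρ hρ2 hT one_pos (by rw [le_div_iff₀ hT, one_mul]; exact hTT')

/-- **Ray statement, lower end face**: `λ ↦ f_T(β/λ)/λ` is non-increasing on `λ > 0` (`β > 0`): the response of the shrunk reference block, rescaled,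
only decreases along the ray — so `TransLE ((1/λ)·Φ₀(S⋆/λ)) …` inequalities propagate from `λ₀` upward. [folklore] -/
theorem qsRespScalar_div_antitone_ray {ρ T β lam lam' : ℝ} (hρ : 0 < ρ) (hρ2 : ρ ≤ 1 / 2) (hT : 0 < T) (hβ : 0 < β)
    (hlam : 0 < lam) (hll : lam ≤ lam') :
    qsRespScalar ρ T (β / lam') / lam' ≤ qsRespScalar ρ T (β / lam) / lam := by
  have hlam' : 0 < lam' := lt_of_lt_of_le hlam hll
  have hmono := mul_qsRespScalar_mono hρ hρ2 hT (div_pos hβ hlam') (div_le_div_of_nonneg_left hβ.le hlam hll)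
  -- `(β/λ')·f(β/λ') ≤ (β/λ)·f(β/λ)`, divide by `β`
  rw [div_le_div_iff₀ hlam' hlam]
  have h := mul_le_mul_of_nonneg_left hmono (by positivity : (0:ℝ) ≤ lam * lam' / β)
  have e1 : lam * lam' / β * (β / lam' * qsRespScalar ρ T (β / lam')) = qsRespScalar ρ T (β / lam') * lam := by
    field_simp
  have e2 : lam * lam' / β * (β / lam * qsRespScalar ρ T (β / lam)) = qsRespScalar ρ T (β / lam) * lam' := by
    field_simp
  rw [e1, e2] at h
  exact h

/-- **Ray statement, upper end face**: `λ ↦ λ·f_T(λβ)` is non-decreasing on `λ > 0` (`β > 0`). [folklore] -/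
theorem mul_qsRespScalar_mul_mono_ray {ρ T β lam lam' : ℝ} (hρ : 0 < ρ) (hρ2 : ρ ≤ 1 / 2) (hT : 0 < T) (hβ : 0 < β)
    (hlam : 0 < lam) (hll : lam ≤ lam') :
    lam * qsRespScalar ρ T (lam * β) ≤ lam' * qsRespScalar ρ T (lam' * β) := by
  have hmono := mul_qsRespScalar_mono hρ hρ2 hT (mul_pos hlam hβ) (mul_le_mul_of_nonneg_right hll hβ.le)
  have h := mul_le_mul_of_nonneg_left hmono (by positivity : (0:ℝ) ≤ 1 / β)
  have e1 : 1 / β * (lam * β * qsRespScalar ρ T (lam * β)) = lam * qsRespScalar ρ T (lam * β) := by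
    field_simp
  have e2 : 1 / β * (lam' * β * qsRespScalar ρ T (lam' * β)) = lam' * qsRespScalar ρ T (lam' * β) := by
    field_simp
  rw [e1, e2] at h
  exact h

end Monotone

/-! ## §4 The closed form of `ϑ` and of the scalar response in the cell's currency -/

section ClosedForm

/-- **Closed form of the realised slot weight**: `ϑ(ρ, T) = (1 − 4ρ/3) − 2/(ρT²) + (2 − E)/(ρ²T³)`,
`E = 2e^{−Tρ} − e^{−T(1−2ρ)} + 2e^{−T(1−ρ)} − e^{−T}` (`0 < ρ ≤ 1/2`, `T > 0`). [cite: MajdaKramer1999, §2.2.1.3 (55)] -/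
theorem slotWeight_eq_closed_form {ρ T : ℝ} (hρ : 0 < ρ) (hρ2 : ρ ≤ 1 / 2) (hT : 0 < T) :
    slotWeight ρ T = (1 - 4 * ρ / 3) - 2 / (ρ * T ^ 2)
      + (2 - (2 * Real.exp (-(T * ρ)) - Real.exp (-(T * (1 - 2 * ρ))) + 2 * Real.exp (-(T * (1 - ρ))) - Real.exp (-T)))
        / (ρ ^ 2 * T ^ 3) := by
  unfold slotWeight
  exact LatticeShear.slotWeight_closed_form hρ hρ2 hT

/-- **Closed form of the scalar quasi-static response** `f_T(a) = ϑ(ρ, Ta)/a` (`a > 0`):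
`f_T(a) = ((1 − 4ρ/3) − 2/(ρ(Ta)²) + (2 − E(Ta))/(ρ²(Ta)³))/a`. [cite: MajdaKramer1999, §2.2.1.3 (55)] -/
theorem qsRespScalar_eq_closed_form {ρ T a : ℝ} (hρ : 0 < ρ) (hρ2 : ρ ≤ 1 / 2) (hT : 0 < T) (ha : 0 < a) :
    qsRespScalar ρ T a = ((1 - 4 * ρ / 3) - 2 / (ρ * (T * a) ^ 2)
      + (2 - (2 * Real.exp (-(T * a * ρ)) - Real.exp (-(T * a * (1 - 2 * ρ))) + 2 * Real.exp (-(T * a * (1 - ρ)))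
          - Real.exp (-(T * a)))) / (ρ ^ 2 * (T * a) ^ 3)) / a := by
  rw [eq_div_iff ha.ne', mul_comm, mul_qsRespScalar_eq_slotWeight]
  exact slotWeight_eq_closed_form hρ hρ2 (mul_pos hT ha)

end ClosedForm

end Summit.AnomalousDissipation.AnomalousDissipation.Theorems.SolenoidalFractalHomogenisation.LagrangianStep
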